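import Summits.BirchSwinnertonDyer.BirchSwinnertonDyer.Theorems.UniversalToricDescentRationalSplitIMCInclusionAtThreeClosedModuloPrint
import Summits.BirchSwinnertonDyer.BirchSwinnertonDyer.Theorems.UniversalToricDescentThinCombReflectionTransfer
import Summits.BirchSwinnertonDyer.BirchSwinnertonDyer.Theorems.UniversalToricDescentThinCombReflectedAvatar
import Summits.BirchSwinnertonDyer.BirchSwinnertonDyer.Theorems.UniversalToricDescentThinCombDisplayFunctionalEquation
import HarnessLib

/-!
# The rational wall `RationalSplitIMCInclusionAtThree` (stmt-BirchSwinnertonDyer-24207) CLOSED MODULO {normalised ♯♯-frame, Jacquet's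
# functional equation on the cone (ONE named print fact, VERBATIM), fibred supply, Nekovář, K2-rat}: the v8.3 candidate with its
# functional-equation input in PRINT currency (certificate, `--supports stmt-BirchSwinnertonDyer-24207`; LEAD `cruxlead-24207` g32)

WHY THIS FILE. `…ClosedModuloV83` (p767197) closed the registered `stub_toricExistsSymmUpTo2` from a normalised frame (N), a DISPLAY-currency
functional equation (FE), a continuation input (P2) and the fibred supply (S), with the functional-equation constant a free parameter
`κ : ℕ → ℤ → ℂ`. This file PINS the constant and the currency: (FE) + (P2) are replaced by ONE hypothesis `hJ` whose text is, word for word,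
the body of the named print fact `Literature.NumberTheory.EllipticCurves.jacquet1972_functionalEquation_rankinSelbergHecke_cone` (Jacquet 1972
Thm. 19.14 / Cor. 19.15 + Tate's local constants: `Γ_ℂ(s+b−1)Γ_ℂ(s+b)·L_φ(s) = (N·|d_K|)^{2+a−b−2s}·Γ_ℂ(a+1−s)Γ_ℂ(a+2−s)·L_{φ⁻¹}(2−s)`,
root number `+1` on the cone; appended to `RankinSelbergHeckeContinuation.lean`, review-queued as p767382 — once it lands, `hJ := h`), and
`κ(N, d_K) := N·|d_K|/4`. The display clause is produced by the kernel glue `…ThinComb.DisplayFunctionalEquation.displayFE_of_lambdaFE_at_one`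
(p767447: `galConj`-invariance of the Euler product, uniqueness of continuation, symmetry of `𝓔(f,ψ)`, `(2π)`-bookkeeping), the partner by
`…ThinComb.ReflectedAvatar.exists_reflected_partner` (p766983), the transfer by `…ThinComb.ReflectionTransfer` (p766642).

* `toricExistsSymmUpTo2_of_normalised_of_jacquetCone hN hJ hS` : the registered `stub_toricExistsSymmUpTo2` (v8.2 signature VERBATIM).
* `RationalSplitIMCInclusionAtThree_of_normalisedToric_of_jacquetCone_of_supply_of_nekovar_of_ratCombDvd` : the crux BY NAME from
  (N) + `hJ` + (S) + Nekovář's fact + `stub_ratCombDvdUpTo2`.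

So the v8.3 residue of stub 1 is EXACTLY: (N) normalised existence at the additive split `3` with `Y = X·N·|d_K|/4` (Hida 1988 Thm. 5.1b,
`p ≥ 5` in print — the adaptation) ⊕ PRINT `hJ` ⊕ (S) the fibred supply (Weil + class-group twist: print; the fibration: kernel-to-do).
HONEST SCOPE: a composition check; v8.3 is NOT registered (v8.2 stays the line of record); none of the inputs is proved here; BSD is not proved by
any of this; 24207 / 20395 / 20186 OPEN.

References: [cite: Jacquet1972, §19 Thm. 19.14, Cor. 19.15] [cite: Tate1979, (3.1), (3.2.3), (3.4)] [cite: Li1979, Thm. 2.2]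
[cite: BuyukbodukLei2017, §2.4 Thm. 2.18, Def. 3.8 (arXiv:1707.00557)] [cite: Hida1988AIF, §5 Thm. 5.1b] [cite: CastellaWan2023, §2.4 Thm. 2.11 (arXiv:1607.02019)]
[cite: Nekovar2006, Thm. 8.9.9, Prop. 9.6.6 (ii)] [cite: Gu2025FiniteSlopeUniversalRS, Conj. 2.15 (arXiv:2512.01184)]
-/

set_option linter.dupNamespace false
set_option autoImplicit false

noncomputable section

open scoped Classical MatrixGroups

namespace Summit.BirchSwinnertonDyer.BirchSwinnertonDyer.Theorems.UniversalToricDescentRatwallThinCombLine.V83Jacquet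

open NumberField IsDedekindDomain Field
open Literature.NumberTheory.EllipticCurves Literature.NumberTheory.GaloisRepresentations
open Literature.NumberTheory.EllipticCurves.ModularForms
open Summit.BirchSwinnertonDyer.BirchSwinnertonDyer.Theorems.UniversalToricDescentThinComb

/-- **The non-trivial element `c̄` of `Gal(K/ℚ)` exchanges the two places above the split prime**: for `K` imaginary quadratic,
`c ∉ res(Γ_K)`, and `𝔭 ≠ 𝔭′` two places of `K` above the same rational prime `3`, `c̄ • 𝔭 = 𝔭′` (and symmetrically `c̄ • 𝔭′ = 𝔭`).
[cite: Washington1997, §13.1] -/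
theorem absGaloisQuot_smul_eq {K : Type} [Field K] [NumberField K] [IsGalois ℚ K] (hK : IsImaginaryQuadratic K)
    {c : Field.absoluteGaloisGroup ℚ} (hc : c ∉ Set.range (absGaloisRestrict ℚ K))
    {𝔭 𝔭' : HeightOneSpectrum (𝓞 K)} (h3 : ((3 : ℕ) : 𝓞 K) ∈ 𝔭.asIdeal) (h3' : ((3 : ℕ) : 𝓞 K) ∈ 𝔭'.asIdeal)
    (hne : 𝔭' ≠ 𝔭) : absGaloisQuot ℚ K c • 𝔭 = 𝔭' := by
  -- adapted from the composition `_of` of `Lines/ratwall_thin_comb.lean` v8 (`hswap`)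
  have hcbar : absGaloisQuot ℚ K c ≠ 1 := fun h ↦ hc ((absGaloisQuot_eq_one_iff ℚ K c).mp h)
  obtain ⟨σ₀, hσ₀⟩ := Literature.NumberTheory.Automorphic.HeightOneSpectrum.exists_algEquiv_smul_eq ℚ
    (Literature.NumberTheory.NumberFields.under_eq_under_of_natCast_mem K h3 h3')
  have hσ₀ne : σ₀ ≠ 1 := by rintro rfl; exact hne (by rw [← hσ₀, one_smul])
  haveI : FiniteDimensional ℚ K := Module.finite_of_finrank_eq_succ hK.1
  have hcard : Fintype.card (K ≃ₐ[ℚ] K) ≤ 2 := hK.1 ▸ AlgEquiv.card_le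
  have hceq : absGaloisQuot ℚ K c = σ₀ := by
    by_contra hne'
    have h3lt : 2 < Fintype.card (K ≃ₐ[ℚ] K) := by
      rw [← Finset.card_univ]
      exact Finset.two_lt_card_iff.mpr ⟨1, absGaloisQuot ℚ K c, σ₀, Finset.mem_univ _, Finset.mem_univ _, Finset.mem_univ _,
        hcbar.symm, hσ₀ne.symm, hne'⟩
    omega
  rw [hceq, hσ₀]

/-- **Clause (ii) DERIVED, print currency**: the registered `stub_toricExistsSymmUpTo2` (v8.2, verbatim) from (N) a NORMALISED ♯♯-frame with
`Y = X·ι′⁻¹(N·|d_K|/4)`, `hJ` = the body of `jacquet1972_functionalEquation_rankinSelbergHecke_cone` VERBATIM, and (S) the fibred supply.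
[cite: Jacquet1972, §19 Thm. 19.14, Cor. 19.15] [cite: Tate1979, (3.1), (3.2.3), (3.4)] [cite: BuyukbodukLei2017, §2.4 Thm. 2.18, Def. 3.8 (arXiv:1707.00557)]
[cite: Hida1988AIF, §5 Thm. 5.1b] -/
theorem toricExistsSymmUpTo2_of_normalised_of_jacquetCone
    (hN :
        ∀ (W : WeierstrassCurve ℚ) [W.IsElliptic] [W.IsGloballyMinimal] (N : ℕ) [NeZero N] (K : Type) [Field K]
          [NumberField K] (Dt : Literature.NumberTheory.EllipticCurves.ModularForms.ModularParametrizationData W N),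
        Summit.BirchSwinnertonDyer.Rank1Residual.Additive.ClassO6 W 3 → W.HasSurjectiveModNGaloisRep 3 →
        W.analyticRank = 1 → W.conductorNorm ℤ = N → IsImaginaryQuadratic K → SatisfiesHeegnerHypothesis N K →
        ∀ (κ' : ZpExtension K 3), κ'.IsAnticyclotomic → ∀ (γ : Field.absoluteGaloisGroup K) [Fact (κ'.IsTopGenerator γ)]
          (𝔭 : HeightOneSpectrum (𝓞 K)), ((3 : ℕ) : 𝓞 K) ∈ 𝔭.asIdeal →
          𝔭.asIdeal.ramificationIdx (𝓞 ℚ) = 1 → 𝔭.asIdeal.inertiaDeg (𝓞 ℚ) = 1 →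
        ∀ (𝔭' : HeightOneSpectrum (𝓞 K)), ((3 : ℕ) : 𝓞 K) ∈ 𝔭'.asIdeal → 𝔭' ≠ 𝔭 →
        ∀ (ι' : PadicAlgCl 3 ≃+* ℂ), Summit.BirchSwinnertonDyer.BirchSwinnertonDyer.Theorems.SchneiderFree.BranchInducesPrime 3 ι' 𝔭 →
        ∀ (κ₁ κ₂ : ZpExtension K 3) (γ₁ γ₂ : Field.absoluteGaloisGroup K) (k : ℕ)
          [Fact (ZpExtension.IsTopGeneratorPair κ₁ κ₂ γ₁ γ₂)],
        (∀ v : HeightOneSpectrum (𝓞 K), v ≠ 𝔭 → ∀ 𝔓 ∈ v.primesAbove,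
            𝔓.inertia (Field.absoluteGaloisGroup K) ≤ κ₁.kerSubgroup) →
        ZpExtension.pairKer κ₁ κ₂ ≤ κ'.kerSubgroup → γ₁ * γ⁻¹ ∈ κ'.kerSubgroup → γ₂ * (γ ^ (3 ^ k))⁻¹ ∈ κ'.kerSubgroup →
        ∃ (ΩK' : ℂ) (C X : ℂ_[3]) (L₂ : PowerSeries (PowerSeries (unrIntegers 3))),
          ΩK' ≠ 0 ∧ C ≠ 0 ∧ X ≠ 0 ∧
          IsToricTwoVarLFunctionUpTo₂ C X
            (X * (((ι'.symm ((N : ℂ) * ((NumberField.discr K).natAbs : ℂ) / 4) : PadicAlgCl 3)) : ℂ_[3]))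
            ι' 𝔭 𝔭' κ₁ κ₂ γ₁ γ₂ Dt.f ΩK' L₂)
    (hJ :
        ∀ (K : Type) [Field K] [NumberField K], IsImaginaryQuadratic K →
        ∀ {N : ℕ} [NeZero N] (f : CuspForm (CongruenceSubgroup.Gamma0 N) 2), IsNewform0 f → SatisfiesHeegnerHypothesis N K →
        ∀ (φ : HeckeCharacter K) (a b : ℕ), 1 ≤ a → 1 ≤ b →
          (∀ v : HeightOneSpectrum (𝓞 K), φ.IsUnramifiedAt v) →
          φ.HasInfinityType (fun _ ↦ (a : ℤ)) (fun _ ↦ -(b : ℤ)) →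
          ∃ L L' : ℂ → ℂ, Differentiable ℂ L ∧ Differentiable ℂ L' ∧
            (∀ s : ℂ, (a : ℝ) + 2 < s.re → L s = rankinSelbergEulerProductHecke f φ s) ∧
            (∀ s : ℂ, (b : ℝ) + 2 < s.re → L' s = rankinSelbergEulerProductHecke f φ⁻¹ s) ∧
            ∀ s : ℂ, (1 : ℝ) - b < s.re → s.re < (a : ℝ) + 1 →
              (2 * (2 * Real.pi : ℂ) ^ (-(s + b - 1)) * Complex.Gamma (s + b - 1)) *
                  (2 * (2 * Real.pi : ℂ) ^ (-(s + b)) * Complex.Gamma (s + b)) * L s =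
                ((N : ℂ) * ((NumberField.discr K).natAbs : ℂ)) ^ ((2 : ℂ) + a - b - 2 * s) *
                  ((2 * (2 * Real.pi : ℂ) ^ (-(a + 1 - s)) * Complex.Gamma (a + 1 - s)) *
                    (2 * (2 * Real.pi : ℂ) ^ (-(a + 2 - s)) * Complex.Gamma (a + 2 - s)) * L' (2 - s)))
    (hS :
        ∀ (K : Type) [Field K] [NumberField K], IsImaginaryQuadratic K →
        ∀ {N : ℕ} [NeZero N] (W : WeierstrassCurve ℚ)
          (Dt : Literature.NumberTheory.EllipticCurves.ModularForms.ModularParametrizationData W N)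
          (𝔭 : HeightOneSpectrum (𝓞 K)), ((3 : ℕ) : 𝓞 K) ∈ 𝔭.asIdeal →
        ∀ (𝔭' : HeightOneSpectrum (𝓞 K)), ((3 : ℕ) : 𝓞 K) ∈ 𝔭'.asIdeal → 𝔭' ≠ 𝔭 →
        ∀ (ι' : PadicAlgCl 3 ≃+* ℂ) (κ₁ κ₂ : ZpExtension K 3) (γ₁ γ₂ : Field.absoluteGaloisGroup K),
          ZpExtension.IsTopGeneratorPair κ₁ κ₂ γ₁ γ₂ →
        (∀ v : HeightOneSpectrum (𝓞 K), v ≠ 𝔭 → ∀ 𝔓 ∈ v.primesAbove,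
            𝔓.inertia (Field.absoluteGaloisGroup K) ≤ κ₁.kerSubgroup) →
        ∃ ϖ : ℂ_[3], ϖ ≠ 0 ∧ ‖ϖ‖ < 1 ∧ ∃ D₂ : Set ℂ_[3], D₂.Infinite ∧ (∀ y ∈ D₂, ‖y‖ ≤ ‖ϖ‖) ∧
          ∀ y ∈ D₂, {x : ℂ_[3] | ‖x‖ ≤ ‖ϖ‖ ∧
            ∃ (ψ : HeckeCharacter K) (a b : ℕ) (r : FramedGaloisRep K (PadicAlgCl 3) 1) (L : ℂ → ℂ),
              1 ≤ a ∧ 1 ≤ b ∧ ψ.HasInfinityType (fun _ ↦ (a : ℤ)) (fun _ ↦ -(b : ℤ)) ∧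
              (∀ w : HeightOneSpectrum (𝓞 K), ψ.IsUnramifiedAt w) ∧ IsPAdicAvatarOf ι' ψ r ∧
              FactorsThroughPair κ₁ κ₂ r ∧ Differentiable ℂ L ∧
              (∀ s : ℂ, (a : ℝ) + 2 < s.re → L s = rankinSelbergEulerProductHecke Dt.f ψ s) ∧
              avatarValueAt r γ₁ - 1 = x ∧ avatarValueAt r γ₂ - 1 = y}.Infinite) :
    ∀ (W : WeierstrassCurve ℚ) [W.IsElliptic] [W.IsGloballyMinimal] (N : ℕ) [NeZero N] (K : Type) [Field K]
      [NumberField K] (Dt : Literature.NumberTheory.EllipticCurves.ModularForms.ModularParametrizationData W N),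
    Summit.BirchSwinnertonDyer.Rank1Residual.Additive.ClassO6 W 3 → W.HasSurjectiveModNGaloisRep 3 →
    W.analyticRank = 1 → W.conductorNorm ℤ = N → IsImaginaryQuadratic K → SatisfiesHeegnerHypothesis N K →
    ∀ (κ' : ZpExtension K 3), κ'.IsAnticyclotomic → ∀ (γ : Field.absoluteGaloisGroup K) [Fact (κ'.IsTopGenerator γ)]
      (𝔭 : HeightOneSpectrum (𝓞 K)), ((3 : ℕ) : 𝓞 K) ∈ 𝔭.asIdeal →
      𝔭.asIdeal.ramificationIdx (𝓞 ℚ) = 1 → 𝔭.asIdeal.inertiaDeg (𝓞 ℚ) = 1 →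
    ∀ (𝔭' : HeightOneSpectrum (𝓞 K)), ((3 : ℕ) : 𝓞 K) ∈ 𝔭'.asIdeal → 𝔭' ≠ 𝔭 →
    ∀ (ι' : PadicAlgCl 3 ≃+* ℂ), Summit.BirchSwinnertonDyer.BirchSwinnertonDyer.Theorems.SchneiderFree.BranchInducesPrime 3 ι' 𝔭 →
    ∀ (κ₁ κ₂ : ZpExtension K 3) (γ₁ γ₂ : Field.absoluteGaloisGroup K) (k : ℕ)
      [Fact (ZpExtension.IsTopGeneratorPair κ₁ κ₂ γ₁ γ₂)],
    (∀ v : HeightOneSpectrum (𝓞 K), v ≠ 𝔭 → ∀ 𝔓 ∈ v.primesAbove,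
        𝔓.inertia (Field.absoluteGaloisGroup K) ≤ κ₁.kerSubgroup) →
    ZpExtension.pairKer κ₁ κ₂ ≤ κ'.kerSubgroup → γ₁ * γ⁻¹ ∈ κ'.kerSubgroup → γ₂ * (γ ^ (3 ^ k))⁻¹ ∈ κ'.kerSubgroup →
    ∃ (ΩK' : ℂ) (C X Y : ℂ_[3]) (L₂ : PowerSeries (PowerSeries (unrIntegers 3))),
      ΩK' ≠ 0 ∧ C ≠ 0 ∧ X ≠ 0 ∧ Y ≠ 0 ∧
      IsToricTwoVarLFunctionUpTo₂ C X Y ι' 𝔭 𝔭' κ₁ κ₂ γ₁ γ₂ Dt.f ΩK' L₂ ∧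
      ∀ (c : Field.absoluteGaloisGroup ℚ), c ∉ Set.range (absGaloisRestrict ℚ K) →
      ∀ (τ : Field.absoluteGaloisGroup K → Field.absoluteGaloisGroup K),
        (∀ σ, absGaloisRestrict ℚ K (τ σ) = c * (absGaloisRestrict ℚ K σ)⁻¹ * c⁻¹) →
      ∀ (A : GL (Fin 2) ℤ_[3]), (A : Matrix (Fin 2) (Fin 2) ℤ_[3]) = IwasawaAlgebra₂.frameMatrixOf κ₁ κ₂ γ₁ γ₂ τ →
        letI : Algebra ℤ_[3] (unrIntegers 3) := (Summit.BirchSwinnertonDyer.Rank1Residual.X11b.Halves.toUnr 3).toAlgebra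
        Associated (IwasawaAlgebra₂.frameSubst (unrIntegers 3) A L₂) L₂ := by
  intro W _ _ N _ K _ _ Dt hO6 hsurj hrk hN' hK hH κ' hκ' γ hγ 𝔭 h3 hram hdeg 𝔭' h3' hne ι' hι κ₁ κ₂ γ₁ γ₂ k hpair hur₁ hker hγ₁ hγ₂
  obtain ⟨ΩK', C, X, L₂, hΩK', hC, hX, hL₂⟩ :=
    hN W N K Dt hO6 hsurj hrk hN' hK hH κ' hκ' γ 𝔭 h3 hram hdeg 𝔭' h3' hne ι' hι κ₁ κ₂ γ₁ γ₂ k hur₁ hker hγ₁ hγ₂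
  set κc : ℂ := (N : ℂ) * ((NumberField.discr K).natAbs : ℂ) / 4 with hκc
  have hκc0 : κc ≠ 0 := by
    refine div_ne_zero (mul_ne_zero (by exact_mod_cast NeZero.ne N) ?_) (by norm_num)
    exact_mod_cast Int.natAbs_ne_zero.mpr (NumberField.discr_ne_zero K)
  set Y : ℂ_[3] := X * (((ι'.symm κc : PadicAlgCl 3)) : ℂ_[3]) with hYdef
  have hY0 : Y ≠ 0 := by
    refine mul_ne_zero hX ?_
    rw [PadicComplex.coe_eq]
    exact (map_ne_zero_iff _ (algebraMap (PadicAlgCl 3) ℂ_[3]).injective).mpr ((map_ne_zero_iff _ ι'.symm.injective).mpr hκc0)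
  refine ⟨ΩK', C, X, Y, L₂, hΩK', hC, hX, hY0, hL₂, ?_⟩
  intro c hc τ hτ A hA
  haveI : IsGalois ℚ K := Literature.FieldTheory.Galois.isGalois_of_finrank_eq_two hK.1
  -- the non-trivial element `g = c̄` of `Gal(K/ℚ)` and the swap of the two places above `3`
  set g := absGaloisQuot ℚ K c with hgdef
  have hg𝔭 : g • 𝔭 = 𝔭' := absGaloisQuot_smul_eq hK hc h3 h3' hne
  have hg𝔭' : g • 𝔭' = 𝔭 := absGaloisQuot_smul_eq hK hc h3' h3 (Ne.symm hne)
  -- the fibred supply in this 𝔭-adapted frame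
  obtain ⟨ϖ, hϖ0, hϖ, D₂, hD₂, hD₂ϖ, hfib⟩ := hS K hK W Dt 𝔭 h3 𝔭' h3' hne ι' κ₁ κ₂ γ₁ γ₂ hpair.out hur₁
  refine ReflectionTransfer.associated_frameSubst_of_toricUpTo₂_of_feRatio hpair.out τ A hA hL₂ (κ := κc) rfl hϖ0 hϖ hD₂ hD₂ϖ
    fun y hy ↦ (hfib y hy).mono fun x hx ↦ ⟨hx.1, ?_⟩
  obtain ⟨ψ, a, b, r, L, ha, hb, hinf, hunr, hr, hrκ, hLd, hLe, hx1, hy1⟩ := hx.2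
  -- the reflected partner `(ψ†, r†)`
  obtain ⟨ψ', r', hψ', hinf', hunr', hr', hrκ', hval⟩ :=
    ReflectedAvatar.exists_reflected_partner hK ι' hpair.out hc hτ hinf hunr hr hrκ
  -- Jacquet at `ψ` (continuations of `ψ`, `ψ⁻¹` and the `Λ`-functional equation) and at `ψ†` (its continuation)
  obtain ⟨L₁, L₁', hL₁, hL₁', hL₁e, hL₁'e, hFE⟩ := hJ K hK Dt.f Dt.isNewformOf.1 hH ψ a b ha hb hunr hinf
  obtain ⟨L'', -, hL'', -, hL''e, -, -⟩ := hJ K hK Dt.f Dt.isNewformOf.1 hH ψ' b a hb ha hunr' hinf'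
  -- the `Λ`-identity at `s = 1`
  have hb' : (1 : ℝ) ≤ b := by exact_mod_cast hb
  have ha' : (1 : ℝ) ≤ a := by exact_mod_cast ha
  have h1 := hFE 1 (by rw [Complex.one_re]; linarith) (by rw [Complex.one_re]; linarith)
  have e1 : (1 : ℂ) + b - 1 = b := by ring
  have e2 : (a : ℂ) + 1 - 1 = a := by ring
  have e3 : (a : ℂ) + 2 - 1 = a + 1 := by ring
  have e4 : (2 : ℂ) + a - b - 2 * 1 = a - b := by ring
  have e5 : (2 : ℂ) - 1 = 1 := by ring
  rw [e1, e2, e3, e4, e5, add_comm (1 : ℂ) (b : ℂ)] at h1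
  -- `L₁ = L` on the nose (both continue the same Euler product from `re s > a + 2`)
  have hLL : L₁ = L := DisplayFunctionalEquation.eq_of_entire_of_eqOn_halfPlane hLd hLe hL₁ hL₁e
  rw [hLL] at h1
  -- the display clause with `κ = N·|d_K|/4`
  have hL''e' : ∀ s : ℂ, (b : ℝ) + 2 < s.re → L'' s = rankinSelbergEulerProductHecke Dt.f (HeckeCharacter.galConj g ψ)⁻¹ s := by
    intro s hs; rw [← hψ']; exact hL''e s hs
  have hdisp := DisplayFunctionalEquation.displayFE_of_lambdaFE_at_one (p := 3) Dt.f g hg𝔭 hg𝔭' hunr ΩK' hL₁' hL₁'e hL'' hL''e' h1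
  rw [← hψ'] at hdisp
  exact ⟨ψ, ψ', a, b, r, r', L, L'', ha, hb, hinf, hunr, hr, hrκ, hLd, hLe, hinf', hunr', hr', hrκ', hL'', hL''e, hval γ₁, hval γ₂,
    hdisp, hx1, hy1⟩

/-- **THE CRUX BY NAME from the v8.3 inputs in print currency**: (N) normalised existence (`Y = X·ι′⁻¹(N·|d_K|/4)`), `hJ` = Jacquet's functional
equation on the cone (the body of the named fact, verbatim), (S) the fibred supply, Nekovář's algebraic functional equation (print fact, stub 2),
and `stub_ratCombDvdUpTo2` (stub 3, OPEN research) — through the v8.1 certificate. [cite: Jacquet1972, §19 Thm. 19.14, Cor. 19.15]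
[cite: Nekovar2006, Thm. 8.9.9, Prop. 9.6.6 (ii)] [cite: Gu2025FiniteSlopeUniversalRS, Conj. 2.15 (arXiv:2512.01184)] [cite: Hida1988AIF, §5 Thm. 5.1b] -/
theorem RationalSplitIMCInclusionAtThree_of_normalisedToric_of_jacquetCone_of_supply_of_nekovar_of_ratCombDvd
    (hN :
        ∀ (W : WeierstrassCurve ℚ) [W.IsElliptic] [W.IsGloballyMinimal] (N : ℕ) [NeZero N] (K : Type) [Field K]
          [NumberField K] (Dt : Literature.NumberTheory.EllipticCurves.ModularForms.ModularParametrizationData W N),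
        Summit.BirchSwinnertonDyer.Rank1Residual.Additive.ClassO6 W 3 → W.HasSurjectiveModNGaloisRep 3 →
        W.analyticRank = 1 → W.conductorNorm ℤ = N → IsImaginaryQuadratic K → SatisfiesHeegnerHypothesis N K →
        ∀ (κ' : ZpExtension K 3), κ'.IsAnticyclotomic → ∀ (γ : Field.absoluteGaloisGroup K) [Fact (κ'.IsTopGenerator γ)]
          (𝔭 : HeightOneSpectrum (𝓞 K)), ((3 : ℕ) : 𝓞 K) ∈ 𝔭.asIdeal →
          𝔭.asIdeal.ramificationIdx (𝓞 ℚ) = 1 → 𝔭.asIdeal.inertiaDeg (𝓞 ℚ) = 1 →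
        ∀ (𝔭' : HeightOneSpectrum (𝓞 K)), ((3 : ℕ) : 𝓞 K) ∈ 𝔭'.asIdeal → 𝔭' ≠ 𝔭 →
        ∀ (ι' : PadicAlgCl 3 ≃+* ℂ), Summit.BirchSwinnertonDyer.BirchSwinnertonDyer.Theorems.SchneiderFree.BranchInducesPrime 3 ι' 𝔭 →
        ∀ (κ₁ κ₂ : ZpExtension K 3) (γ₁ γ₂ : Field.absoluteGaloisGroup K) (k : ℕ)
          [Fact (ZpExtension.IsTopGeneratorPair κ₁ κ₂ γ₁ γ₂)],
        (∀ v : HeightOneSpectrum (𝓞 K), v ≠ 𝔭 → ∀ 𝔓 ∈ v.primesAbove,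
            𝔓.inertia (Field.absoluteGaloisGroup K) ≤ κ₁.kerSubgroup) →
        ZpExtension.pairKer κ₁ κ₂ ≤ κ'.kerSubgroup → γ₁ * γ⁻¹ ∈ κ'.kerSubgroup → γ₂ * (γ ^ (3 ^ k))⁻¹ ∈ κ'.kerSubgroup →
        ∃ (ΩK' : ℂ) (C X : ℂ_[3]) (L₂ : PowerSeries (PowerSeries (unrIntegers 3))),
          ΩK' ≠ 0 ∧ C ≠ 0 ∧ X ≠ 0 ∧
          IsToricTwoVarLFunctionUpTo₂ C X
            (X * (((ι'.symm ((N : ℂ) * ((NumberField.discr K).natAbs : ℂ) / 4) : PadicAlgCl 3)) : ℂ_[3]))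
            ι' 𝔭 𝔭' κ₁ κ₂ γ₁ γ₂ Dt.f ΩK' L₂)
    (hJ :
        ∀ (K : Type) [Field K] [NumberField K], IsImaginaryQuadratic K →
        ∀ {N : ℕ} [NeZero N] (f : CuspForm (CongruenceSubgroup.Gamma0 N) 2), IsNewform0 f → SatisfiesHeegnerHypothesis N K →
        ∀ (φ : HeckeCharacter K) (a b : ℕ), 1 ≤ a → 1 ≤ b →
          (∀ v : HeightOneSpectrum (𝓞 K), φ.IsUnramifiedAt v) →
          φ.HasInfinityType (fun _ ↦ (a : ℤ)) (fun _ ↦ -(b : ℤ)) →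
          ∃ L L' : ℂ → ℂ, Differentiable ℂ L ∧ Differentiable ℂ L' ∧
            (∀ s : ℂ, (a : ℝ) + 2 < s.re → L s = rankinSelbergEulerProductHecke f φ s) ∧
            (∀ s : ℂ, (b : ℝ) + 2 < s.re → L' s = rankinSelbergEulerProductHecke f φ⁻¹ s) ∧
            ∀ s : ℂ, (1 : ℝ) - b < s.re → s.re < (a : ℝ) + 1 →
              (2 * (2 * Real.pi : ℂ) ^ (-(s + b - 1)) * Complex.Gamma (s + b - 1)) *
                  (2 * (2 * Real.pi : ℂ) ^ (-(s + b)) * Complex.Gamma (s + b)) * L s =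
                ((N : ℂ) * ((NumberField.discr K).natAbs : ℂ)) ^ ((2 : ℂ) + a - b - 2 * s) *
                  ((2 * (2 * Real.pi : ℂ) ^ (-(a + 1 - s)) * Complex.Gamma (a + 1 - s)) *
                    (2 * (2 * Real.pi : ℂ) ^ (-(a + 2 - s)) * Complex.Gamma (a + 2 - s)) * L' (2 - s)))
    (hS :
        ∀ (K : Type) [Field K] [NumberField K], IsImaginaryQuadratic K →
        ∀ {N : ℕ} [NeZero N] (W : WeierstrassCurve ℚ)
          (Dt : Literature.NumberTheory.EllipticCurves.ModularForms.ModularParametrizationData W N)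
          (𝔭 : HeightOneSpectrum (𝓞 K)), ((3 : ℕ) : 𝓞 K) ∈ 𝔭.asIdeal →
        ∀ (𝔭' : HeightOneSpectrum (𝓞 K)), ((3 : ℕ) : 𝓞 K) ∈ 𝔭'.asIdeal → 𝔭' ≠ 𝔭 →
        ∀ (ι' : PadicAlgCl 3 ≃+* ℂ) (κ₁ κ₂ : ZpExtension K 3) (γ₁ γ₂ : Field.absoluteGaloisGroup K),
          ZpExtension.IsTopGeneratorPair κ₁ κ₂ γ₁ γ₂ →
        (∀ v : HeightOneSpectrum (𝓞 K), v ≠ 𝔭 → ∀ 𝔓 ∈ v.primesAbove,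
            𝔓.inertia (Field.absoluteGaloisGroup K) ≤ κ₁.kerSubgroup) →
        ∃ ϖ : ℂ_[3], ϖ ≠ 0 ∧ ‖ϖ‖ < 1 ∧ ∃ D₂ : Set ℂ_[3], D₂.Infinite ∧ (∀ y ∈ D₂, ‖y‖ ≤ ‖ϖ‖) ∧
          ∀ y ∈ D₂, {x : ℂ_[3] | ‖x‖ ≤ ‖ϖ‖ ∧
            ∃ (ψ : HeckeCharacter K) (a b : ℕ) (r : FramedGaloisRep K (PadicAlgCl 3) 1) (L : ℂ → ℂ),
              1 ≤ a ∧ 1 ≤ b ∧ ψ.HasInfinityType (fun _ ↦ (a : ℤ)) (fun _ ↦ -(b : ℤ)) ∧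
              (∀ w : HeightOneSpectrum (𝓞 K), ψ.IsUnramifiedAt w) ∧ IsPAdicAvatarOf ι' ψ r ∧
              FactorsThroughPair κ₁ κ₂ r ∧ Differentiable ℂ L ∧
              (∀ s : ℂ, (a : ℝ) + 2 < s.re → L s = rankinSelbergEulerProductHecke Dt.f ψ s) ∧
              avatarValueAt r γ₁ - 1 = x ∧ avatarValueAt r γ₂ - 1 = y}.Infinite)
    (hNek : Literature.NumberTheory.EllipticCurves.nekovar2006_xGr₂_isTorsion_iff_and_charIdeal_eq_map_inv)
    (hK2 :
        ∀ (W : WeierstrassCurve ℚ) [W.IsElliptic] [W.IsGloballyMinimal] (N : ℕ) [NeZero N] (K : Type) [Field K]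
          [NumberField K] (Dt : Literature.NumberTheory.EllipticCurves.ModularForms.ModularParametrizationData W N),
        Summit.BirchSwinnertonDyer.Rank1Residual.Additive.ClassO6 W 3 → W.HasSurjectiveModNGaloisRep 3 →
        W.analyticRank = 1 → W.conductorNorm ℤ = N → IsImaginaryQuadratic K → SatisfiesHeegnerHypothesis N K →
        ∀ (𝔭 : HeightOneSpectrum (𝓞 K)), ((3 : ℕ) : 𝓞 K) ∈ 𝔭.asIdeal →
          𝔭.asIdeal.ramificationIdx (𝓞 ℚ) = 1 → 𝔭.asIdeal.inertiaDeg (𝓞 ℚ) = 1 →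
        ∀ (𝔭' : HeightOneSpectrum (𝓞 K)), ((3 : ℕ) : 𝓞 K) ∈ 𝔭'.asIdeal → 𝔭' ≠ 𝔭 →
        ∀ (ι' : PadicAlgCl 3 ≃+* ℂ), Summit.BirchSwinnertonDyer.BirchSwinnertonDyer.Theorems.SchneiderFree.BranchInducesPrime 3 ι' 𝔭 →
        ∀ (κ₁ κ₂ : ZpExtension K 3) (γ₁ γ₂ : Field.absoluteGaloisGroup K)
          [Fact (ZpExtension.IsTopGeneratorPair κ₁ κ₂ γ₁ γ₂)],
        (∀ v : HeightOneSpectrum (𝓞 K), v ≠ 𝔭 → ∀ 𝔓 ∈ v.primesAbove,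
            𝔓.inertia (Field.absoluteGaloisGroup K) ≤ κ₁.kerSubgroup) →
        Module.Finite (IwasawaAlgebra₂ 3) ((W.baseChange K).XGr₂ 3 κ₁ κ₂ 𝔭' γ₁ γ₂) →
        Module.IsTorsion (IwasawaAlgebra₂ 3) ((W.baseChange K).XGr₂ 3 κ₁ κ₂ 𝔭' γ₁ γ₂) →
        ∀ (g : IwasawaAlgebra₂ 3),
          Literature.NumberTheory.EllipticCurves.Module.charIdeal (IwasawaAlgebra₂ 3)
            ((W.baseChange K).XGr₂ 3 κ₁ κ₂ 𝔭' γ₁ γ₂) = Ideal.span {g} →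
        ∀ (ΩK' : ℂ) (C X Y : ℂ_[3]) (L₂ : PowerSeries (PowerSeries (unrIntegers 3))), ΩK' ≠ 0 → C ≠ 0 → X ≠ 0 → Y ≠ 0 →
          IsToricTwoVarLFunctionUpTo₂ C X Y ι' 𝔭 𝔭' κ₁ κ₂ γ₁ γ₂ Dt.f ΩK' L₂ →
        ThinCombDvdRat (unrIntegers 3) 3
          (PowerSeries.map (PowerSeries.map (Summit.BirchSwinnertonDyer.Rank1Residual.X11b.Halves.toUnr 3)) g) L₂) :
    Summit.BirchSwinnertonDyer.BirchSwinnertonDyer.Theses.UniversalToricDescent.RationalSplitIMCInclusionAtThree :=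
  RationalSplitIMCInclusionAtThree_of_toricExistsSymm_of_nekovar_of_ratCombDvd
    (toricExistsSymmUpTo2_of_normalised_of_jacquetCone hN hJ hS) hNek hK2

end Summit.BirchSwinnertonDyer.BirchSwinnertonDyer.Theorems.UniversalToricDescentRatwallThinCombLine.V83Jacquet

end
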